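import Summits.BirchSwinnertonDyer.BirchSwinnertonDyer.Theses.LeadingTerm
import Summits.BirchSwinnertonDyer.BirchSwinnertonDyer.Theorems.PAdicOrderV2PAdicOrderComparisonR2StubTwoLeOrder
import Literature.NumberTheory.EllipticCurves.PAdicGrossZagierConstantTermProofs
import Literature.NumberTheory.EllipticCurves.BSDHeegnerPointsGrossZagierProofs
import Literature.NumberTheory.EllipticCurves.CanonicalPAdicHeightHolds
import Literature.NumberTheory.EllipticCurves.RootNumberEvenAnalyticRankProofs
import Literature.NumberTheory.EllipticCurves.HeegnerHypothesisKroneckerProofs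
import Literature.NumberTheory.QuadraticFields.SquareRootGenerator
import Literature.NumberTheory.QuadraticForms.PadicSquares
import HarnessLib

/-!
# BirchSwinnertonDyer / LeadingTerm — crux `Consistency` (stmt-BirchSwinnertonDyer-16217),
# line `Sketch`, stub S1a `stub_deficient_one_odd`: conditional closure (torsion transfer)

Registered stub S1a of `Cruxes/Consistency/Lines/Sketch.lean`: for `E/ℚ` (globally minimal `W`),
a good ordinary `p ≥ 5` and the newform `f` of `E`, in the cell `(r_MW, r_an) = (1, odd ≥ 3)`
the coefficient `[T¹]` of `L_p(E,T) = padicLFunction f (unitRoot W p)` vanishes.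
KNOWN IN PRINT, not provable in the tree today (Perrin-Riou's `p`-adic Gross–Zagier
formula, Invent. Math. 89 (1987), Thm. 1.3 = the named fact `perrinRiou_padicGrossZagier`).
`stub_deficient_one_odd_of_facts` records, machine-checked, that the stub FOLLOWS from the
∀-closures of four named Literature facts and ONE sharpened supply statement (TORSION TRANSFER):
`r_an` odd ⇒ `w(E) = -1` (modularity) ⇒ a Heegner field `K` (imaginary quadratic, every
`ℓ ∣ N_E` split, `p` split, `L(E^{(d_K)}, 1) ≠ 0`, `d_K` ODD: the Friedberg–Hoffstein supply
`friedbergHoffstein_exists_heegnerField_split_twist_ne_zero` sharpened by the one conjunct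
`Odd d_K` — TODO(general form)) ⇒ a Heegner point `P_K ∈ E(K)` (`exists_isHeegnerPoint`),
TORSION as `L'(E/K,1) = L'(E,1)L(E^K,1) + L(E,1)L'(E^K,1) = 0` for `r_an(E) ≥ 2` (`gross_zagier`:
`L'(E/K,1) ≠ 0 ↔ P_K` non-torsion) ⇒ its canonical `p`-adic height is `0` ⇒
`[T¹] L_p(E/K,T) = 0` (Perrin-Riou) ⇒ as `L_p(E/K) = L_p(f,α) L_p(g,α)` (`p` split),
`L_p(f,α,0) = 0` (`stub_constantCoeff_eq_zero_iff`), `L_p(g,α,0) = (1-α⁻¹)² [0]⁺_g ≠ 0`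
(`constantCoeff_padicLFunction_twist`, `L(E^K,1) ≠ 0`): `[T¹] L_p(f,α) = 0`. Tree theorems
otherwise; the canonical cyclotomic `p`-adic height over `K` EXISTS (`s1a_exists_isCanonicalK` =
the proof of `exists_isCanonicalK_holds` without its unused instance
`[(W ⊗ K).IsGloballyMinimal]`; it needs `#(K →+* ℚ_p) = 2`, `s1a_card_ringHom_padic`, from
`p` split by Hensel's lemma). The hypothesis `r_MW = 1` of the registered signature is not used.
-/

set_option linter.dupNamespace false

namespace Summit.BirchSwinnertonDyer.BirchSwinnertonDyer.Theorems

open scoped Classical MatrixGroups ModularForm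
open CongruenceSubgroup Literature.NumberTheory.EllipticCurves
  Literature.NumberTheory.EllipticCurves.ModularForms WeierstrassCurve

/-- **Hensel for `√d`, odd `p`**: an integer which is a non-zero square mod `p ≠ 2` is a
non-zero square in `ℚ_p` (lift `b`, `b² ≡ d`, to a unit of `ℤ_p`; `d/b² ≡ 1` is a square,
`padicInt_isSquare_of_toZMod_eq_one`). [cite: Serre1973, Ch. II §3.3 Thm 3] -/
theorem s1a_exists_sq_eq_padic {p : ℕ} [Fact p.Prime] (hp2 : p ≠ 2) {d : ℤ}
    (hsq : IsSquare ((d : ℤ) : ZMod p)) (hd0 : ((d : ℤ) : ZMod p) ≠ 0) :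
    ∃ s : ℚ_[p], s ≠ 0 ∧ s ^ 2 = (d : ℚ_[p]) := by
  obtain ⟨b, hb⟩ := hsq
  set bt : ℤ_[p] := (b.val : ℤ_[p]) with hbt
  have hbtb : PadicInt.toZMod bt = b := by rw [hbt, map_natCast, ZMod.natCast_zmod_val]
  have hunit : IsUnit bt := by
    by_contra hnu
    have hmem : bt ∈ IsLocalRing.maximalIdeal ℤ_[p] := (IsLocalRing.mem_maximalIdeal _).mpr hnu
    rw [← PadicInt.ker_toZMod, RingHom.mem_ker, hbtb] at hmem
    exact hd0 (by rw [hb, hmem, mul_zero])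
  obtain ⟨w, hw⟩ := hunit.exists_right_inv
  have h1 : PadicInt.toZMod ((d : ℤ_[p]) * w * w) = 1 := by
    have hw' : b * PadicInt.toZMod w = 1 := by rw [← hbtb, ← map_mul, hw, map_one]
    rw [map_mul, map_mul, map_intCast, hb]
    linear_combination (b * PadicInt.toZMod w + 1) * hw'
  obtain ⟨r, hr⟩ :=
    Literature.NumberTheory.QuadraticForms.padicInt_isSquare_of_toZMod_eq_one hp2 h1
  have hd : (d : ℤ_[p]) = (r * bt) * (r * bt) := by
    calc (d : ℤ_[p]) = (d : ℤ_[p]) * (bt * w) * (bt * w) := by rw [hw, mul_one, mul_one]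
      _ = (d : ℤ_[p]) * w * w * (bt * bt) := by ring
      _ = (r * bt) * (r * bt) := by rw [hr]; ring
  refine ⟨((r * bt : ℤ_[p]) : ℚ_[p]), fun h0 ↦ hd0 ?_, ?_⟩
  · have h0' : r * bt = 0 := by_contra fun h ↦ (PadicInt.coe_ne_zero.2 h) h0
    have : PadicInt.toZMod (d : ℤ_[p]) = 0 := by rw [hd, h0', mul_zero, map_zero]
    rwa [map_intCast] at this
  · rw [sq, ← PadicInt.coe_mul, ← hd]; simp

/-- **A prime split in a quadratic field `K` is totally split in the embedding sense,
`#(K →+* ℚ_p) = 2 = [K:ℚ]`** (`p` odd): `K = ℚ(θ)` with `θ² = d_K` (`d_K = c q²` for any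
square-root generator, `NumberField.exists_discr_eq_mul_sq`), `(d_K/p) = 1` for `p` split
(`isSquare_discr_of_ncard_primesOver_eq_two`), so `X² - d_K`, hence `minpoly θ`, splits in
`ℚ_p` (Hensel) and `#(ℚ(θ) →ₐ ℚ_p) = deg minpoly θ = 2` (`card_algHom_adjoin_integral`;
Marcus, *Number Fields*, Ch. 3, Thm. 25). [cite: Marcus2018, Ch. 3 Thm. 25] -/
theorem s1a_card_ringHom_padic {K : Type*} [Field K] [NumberField K]
    (h2 : Module.finrank ℚ K = 2) {p : ℕ} [Fact p.Prime] (hp2 : p ≠ 2)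
    (hsplit : ((Ideal.span {(p : ℤ)}).primesOver (NumberField.RingOfIntegers K)).ncard = 2) :
    Fintype.card (K →+* ℚ_[p]) = Module.finrank ℚ K := by
  -- `K = ℚ(θ)` with `θ² = d_K`
  obtain ⟨θ₀, c, hθ₀, hc⟩ :=
    Literature.NumberTheory.QuadraticFields.Quadratic.exists_sq_eq_algebraMap (F := ℚ) (K := K) h2
  obtain ⟨q, hq0, hdq⟩ := NumberField.exists_discr_eq_mul_sq h2 hθ₀ hc
  set θ : K := algebraMap ℚ K q * θ₀ with hθdef
  have hθsq : θ ^ 2 = algebraMap ℚ K (NumberField.discr K : ℚ) := by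
    rw [hθdef, mul_pow, ← map_pow, hc, ← map_mul, hdq, mul_comm]
  have hθ : θ ∉ Set.range (algebraMap ℚ K) := fun ⟨r, hr⟩ ↦ hθ₀ ⟨r / q, by
    rw [map_div₀, hr, hθdef, mul_div_cancel_left₀ _ ((map_ne_zero _).mpr hq0)]⟩
  -- `X² - d_K` splits in `ℚ_p`, hence so does the minimal polynomial of `θ`
  obtain ⟨hsqp, hd0p⟩ := isSquare_discr_of_ncard_primesOver_eq_two h2 Fact.out hsplit
  obtain ⟨s, -, hs⟩ := s1a_exists_sq_eq_padic hp2 hsqp hd0p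
  have hint : IsIntegral ℚ θ := .of_finite ℚ θ
  set P : Polynomial ℚ := Polynomial.X ^ 2 - Polynomial.C (NumberField.discr K : ℚ) with hP
  have hPθ : Polynomial.aeval θ P = 0 := by simp [hP, hθsq]
  have hPmap : P.map (algebraMap ℚ ℚ_[p]) =
      (Polynomial.X - Polynomial.C s) * (Polynomial.X + Polynomial.C s) := by
    have hds : (algebraMap ℚ ℚ_[p]) (NumberField.discr K : ℚ) = s * s := by
      rw [← sq, hs]; simp
    rw [hP, Polynomial.map_sub, Polynomial.map_pow, Polynomial.map_X, Polynomial.map_C, hds,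
      Polynomial.C_mul]
    ring
  have hsplits : ((minpoly ℚ θ).map (algebraMap ℚ ℚ_[p])).Splits := by
    refine Polynomial.Splits.of_dvd ?_ ?_ (Polynomial.map_dvd _ (minpoly.dvd ℚ θ hPθ)) <;>
      rw [hPmap]
    · exact (Polynomial.Splits.X_sub_C s).mul (Polynomial.Splits.X_add_C s)
    · exact mul_ne_zero (Polynomial.X_sub_C_ne_zero s) (Polynomial.X_add_C_ne_zero s)
  -- `deg minpoly θ = 2`, so `ℚ⟮θ⟯ = K` and the embeddings are counted by the roots
  have hdeg : (minpoly ℚ θ).natDegree = 2 :=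
    le_antisymm ((minpoly.natDegree_le θ).trans h2.le)
      ((minpoly.two_le_natDegree_iff hint).mpr fun ⟨r, hr⟩ ↦ hθ ⟨r, hr⟩)
  have htop : IntermediateField.adjoin ℚ {θ} = ⊤ :=
    IntermediateField.eq_of_le_of_finrank_le le_top
      (by rw [IntermediateField.finrank_top', IntermediateField.adjoin.finrank hint, hdeg, h2])
  have hcard := IntermediateField.card_algHom_adjoin_integral ℚ (K := ℚ_[p]) hint
    (Algebra.IsSeparable.isSeparable ℚ θ) hsplits
  rw [hdeg] at hcard
  have e : IntermediateField.adjoin ℚ {θ} ≃ₐ[ℚ] K :=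
    (IntermediateField.equivOfEq htop).trans IntermediateField.topEquiv
  calc Fintype.card (K →+* ℚ_[p]) = Nat.card (K →+* ℚ_[p]) := Fintype.card_eq_nat_card
    _ = Nat.card (K →ₐ[ℚ] ℚ_[p]) := Nat.card_congr RingHom.equivRatAlgHom
    _ = Nat.card (IntermediateField.adjoin ℚ {θ} →ₐ[ℚ] ℚ_[p]) :=
        (Nat.card_congr (AlgEquiv.arrowCongr e (AlgEquiv.refl : ℚ_[p] ≃ₐ[ℚ] ℚ_[p]))).symm
    _ = 2 := hcard
    _ = Module.finrank ℚ K := h2.symm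

/-- **The canonical cyclotomic `p`-adic height over `K` exists** (`p ≥ 5` good ordinary,
totally split in `K`): the conclusion of the named fact `WeierstrassCurve.exists_isCanonicalK`,
proved exactly as its discharge `exists_isCanonicalK_of_MT_theta` (from
`mazur_tate_sigma_existsUnique_holds` and `padicSigma_theta_formal_holds`: the admissible locus
is a torsion-free subgroup on which the parallelogram law of the sigma formula gives a pairing),
but WITHOUT the fact's instance argument `[(W.baseChange K).IsGloballyMinimal]`, never used there.
[cite: MazurSteinTate2006, §2.8] [cite: BalakrishnanCiperianiStein2015, §4.1 eq. (4.1)] -/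
theorem s1a_exists_isCanonicalK (W : WeierstrassCurve ℚ) [W.IsElliptic] [W.IsGloballyMinimal]
    (K : Type) [Field K] [NumberField K] (p : ℕ) [Fact p.Prime] (hp : 5 ≤ p)
    (hgood : W.HasGoodReductionAtPrime p) (hord : ¬ (p : ℤ) ∣ W.frobeniusTrace p)
    (hsplit : Fintype.card (K →+* ℚ_[p]) = Module.finrank ℚ K) :
    ∃ DK : WeierstrassCurve.PAdicHeightDataK W p K, DK.IsCanonical := by
  -- adapted from `WeierstrassCurve.exists_isCanonicalK_of_MT_theta` (CanonicalPAdicHeightKProofs)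
  have hp2 : p ≠ 2 := by omega
  haveI : (W.baseChange K).IsElliptic := by rw [baseChange]; infer_instance
  obtain ⟨H, hH⟩ := exists_addSubgroup_coe_eq_localConditionsLocusK W K hp2
  have hmem : ∀ P, P ∈ H ↔ P = 0 ∨ W.SatisfiesLocalConditionsK p K P := fun P ↦ by
    rw [← SetLike.mem_coe, hH]; rfl
  have hslc : ∀ P ∈ H, P ≠ 0 → W.SatisfiesLocalConditionsK p K P := fun P hP h0 ↦
    ((hmem P).mp hP).resolve_left h0
  have hne : Nonempty (K →+* ℚ_[p]) := by
    rw [← Fintype.card_pos_iff, hsplit]; exact Module.finrank_pos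
  obtain ⟨ι₀⟩ := hne
  have htf' : ∀ P ∈ H, IsOfFinAddOrder P → P = 0 := by
    intro P hP hfin
    by_contra h0
    cases P with
    | zero => exact h0 rfl
    | some x y h =>
      exact not_isOfFinAddOrder_of_one_lt_norm_emb (by omega) ι₀ h ((hslc _ hP h0).1 ι₀).1
        hfin
  have hfull := parallelogram_of_generic H htf' (W.canonicalPAdicHeightK p K) rfl
    fun P hP Q hQ hP0 hQ0 hPQ hPQ' ↦
      canonicalPAdicHeightK_parallelogram_of_MT_theta mazur_tate_sigma_existsUnique_holds
        padicSigma_theta_formal_holds W K p hp hgood hord hsplit P Q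
        (hslc P hP hP0) (hslc Q hQ hQ0) hPQ hPQ'
  obtain ⟨B, hsymm, htors, hdiag⟩ := exists_pairing_of_parallelogram H _ hfull
  exact ⟨⟨B, hsymm, fun P Q hP ↦ htors P Q hP⟩, hsplit,
    fun P hP ↦ hdiag P ((hmem P).mpr (Or.inr hP.2))⟩

/-- **`L'(E/K, 1) = 0` when `ord_{s=1} L(E,s) ≥ 2`**: `L(E/K,s) = L(E,s) L(E^{(d_K)},s)`
(`LDerivEK`), both factors entire (Hecke, from the newforms `f`, `g`), and
`L(E,1) = L'(E,1) = 0` below the analytic order, so the product rule gives `0`.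
[cite: GrossZagier1986, I.§7] -/
theorem s1a_lDerivEK_eq_zero (W : WeierstrassCurve ℚ) [W.IsElliptic] (K : Type) [Field K]
    [NumberField K] {Nf Ng : ℕ} [NeZero Nf] [NeZero Ng] {f : CuspForm (Gamma0 Nf) 2}
    {g : CuspForm (Gamma0 Ng) 2} (hf : IsNewformOf W f)
    (hg : IsNewformOf (W.quadraticTwist (NumberField.discr K : ℚ)) g)
    (h2 : 2 ≤ W.analyticRank) : LDerivEK W K = 0 := by
  have hE : W.HasEntireLFunction :=
    WeierstrassCurve.hasEntireLFunction_of_cuspCoeff_eq (strictWidthInfty_Gamma0 Nf) W f hf.2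
  have hEt : (W.quadraticTwist (NumberField.discr K : ℚ)).HasEntireLFunction :=
    WeierstrassCurve.hasEntireLFunction_of_cuspCoeff_eq (strictWidthInfty_Gamma0 Ng) _ g hg.2
  have han : AnalyticAt ℂ W.entireLFunction 1 :=
    (W.differentiable_entireLFunction hE).analyticAt 1
  have hle : ((2 : ℕ) : ℕ∞) ≤ analyticOrderAt W.entireLFunction 1 := by
    by_cases htop : analyticOrderAt W.entireLFunction 1 = ⊤
    · rw [htop]; exact le_top
    · unfold WeierstrassCurve.analyticRank analyticOrderNatAt at h2
      rw [← ENat.coe_toNat htop]; exact_mod_cast h2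
  have hzero := (natCast_le_analyticOrderAt_iff_iteratedDeriv_eq_zero han).mp hle
  have h0 : W.entireLFunction 1 = 0 := by simpa using hzero 0 (by norm_num)
  have h1 : deriv W.entireLFunction 1 = 0 := by simpa using hzero 1 (by norm_num)
  unfold LDerivEK
  rw [deriv_fun_mul ((W.differentiable_entireLFunction hE) 1)
    (((W.quadraticTwist _).differentiable_entireLFunction hEt) 1), h0, h1, zero_mul, zero_mul,
    add_zero]

/-- **Stub S1a from Perrin-Riou's `p`-adic Gross–Zagier formula, by torsion transfer.**
Colon form. Antecedents: (1) the named fact `perrinRiou_padicGrossZagier` (Perrin-Riou 1987,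
Thm. 1.3: `[T¹]L_p(E/K,T) = 0 ↔ ⟨P_K,P_K⟩_p = 0`); (2) the ∀-closure of the named fact
`gross_zagier N W K` (Gross–Zagier 1986, Thm. I.6.3: `L'(E/K,1) = c·ĥ(P_K)`, `c > 0`, so
`L'(E/K,1) ≠ 0 ↔ P_K` non-torsion, `lDerivEK_ne_zero_iff_not_isOfFinAddOrder`); (3) the
∀-closure of the named fact `exists_isHeegnerPoint W K`; (4) the named fact
`ModularForms.exists_isNewformOf` (modularity: `w(E) = (-1)^{r_an}`,
`rootNumber_eq_neg_one_pow_analyticRank_of_exists_isNewformOf`, and the newform `g` of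
`E^{(d_K)}`); (5) the SHARPENED SUPPLY: the body of the named fact
`friedbergHoffstein_exists_heegnerField_split_twist_ne_zero` (Friedberg–Hoffstein 1995; BSTW
2024, Part II, proof of Thm. 4.3) verbatim with the ONE extra conjunct `Odd (NumberField.discr K)`
(PR87 §1.4 assumes `D` odd; in print one more local condition, at `2`, in Friedberg–Hoffstein's
theorem — TODO(general form): not a tree fact as stated). Consequent: the registered stub
`stub_deficient_one_odd` of line `Sketch` verbatim (names fully qualified). Proof (module
docstring): `(d_K, N_E) = 1` (`SatisfiesHeegnerHypothesis.coprime_discr`), the canonical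
`K`-height exists (`s1a_exists_isCanonicalK`, `s1a_card_ringHom_padic`), the Heegner point is
torsion (`s1a_lDerivEK_eq_zero`, `r_an ≥ 2`), so of height `0` (`PAdicHeightDataK.map_torsion`),
`coeff_1 (L_p(f) L_p(g)) = L_p(f,0)·[T¹]L_p(g) + [T¹]L_p(f)·L_p(g,0)` with `L_p(f,0) = 0`
(`stub_constantCoeff_eq_zero_iff`) and `L_p(g,0) = (1-α⁻¹)²[0]⁺_g ≠ 0`
(`constantCoeff_padicLFunction_twist`, `s1_unitRoot_coe_ne_one`,
`s1_ratPlusSymbol_zero_eq_zero_iff`, `L(E^{(d_K)},1) ≠ 0`). `r_MW = 1` is not used.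
[cite: PerrinRiou1987, Thm. 1.3 (§1.4, p. 461) and (1.1)] [cite: GrossZagier1986, Thm. I.6.3]
[cite: FriedbergHoffstein1995, main theorem] [cite: BCDTJAMS2001, Thm. A] -/
theorem stub_deficient_one_odd_of_facts :
    Literature.NumberTheory.EllipticCurves.perrinRiou_padicGrossZagier →
    (∀ (N : ℕ) [NeZero N] (W : WeierstrassCurve ℚ) (K : Type) [Field K] [NumberField K],
      Literature.NumberTheory.EllipticCurves.gross_zagier N W K) →
    (∀ (W : WeierstrassCurve ℚ) (K : Type) [Field K] [NumberField K],
      Literature.NumberTheory.EllipticCurves.exists_isHeegnerPoint W K) →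
    Literature.NumberTheory.EllipticCurves.ModularForms.exists_isNewformOf →
    (∀ (W : WeierstrassCurve ℚ) [W.IsElliptic], W.rootNumber = -1 → ∀ (p : ℕ), p.Prime →
      ∀ B : ℕ, ∃ (K : Type) (_ : Field K) (_ : NumberField K),
        Literature.NumberTheory.EllipticCurves.IsImaginaryQuadratic K ∧
          B < (NumberField.discr K).natAbs ∧
          Literature.NumberTheory.EllipticCurves.SatisfiesHeegnerHypothesis
            (W.conductorNorm ℤ) K ∧
          Literature.NumberTheory.EllipticCurves.SatisfiesHeegnerHypothesis p K ∧
          (W.quadraticTwist (NumberField.discr K : ℚ)).entireLFunction 1 ≠ 0 ∧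
          Odd (NumberField.discr K)) →
    ∀ (W : WeierstrassCurve ℚ) [W.IsElliptic] [W.IsGloballyMinimal] (p : ℕ) [Fact p.Prime],
      5 ≤ p → Literature.NumberTheory.EllipticCurves.IsOrdinaryAt W p →
      ∀ {N : ℕ} [NeZero N] (f : CuspForm (CongruenceSubgroup.Gamma0 N) 2),
        Literature.NumberTheory.EllipticCurves.ModularForms.IsNewformOf W f →
        W.mordellWeilRank = 1 → Odd W.analyticRank → 3 ≤ W.analyticRank →
          PowerSeries.coeff 1 (Literature.NumberTheory.EllipticCurves.padicLFunction f
            (Literature.NumberTheory.EllipticCurves.unitRoot W p : ℚ_[p])) = 0 := by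
  intro hPR hGZ hHeeg hmod hFH W _ _ p _ h5 hord N _ f hf _ hodd h3
  have hp : p.Prime := Fact.out
  haveI : NeZero (W.conductorNorm ℤ) := ⟨(W.conductorNorm_pos_holds).ne'⟩
  -- Step 1: `w(E) = -1` (modularity and odd analytic rank)
  have hw : W.rootNumber = -1 := by
    rw [W.rootNumber_eq_neg_one_pow_analyticRank_of_exists_isNewformOf hmod, hodd.neg_one_pow]
  -- Step 2: the Heegner field `K` (`p` split, odd `d_K` prime to `N_E`, `L(E^K, 1) ≠ 0`)
  obtain ⟨K, _, _, hK, -, hHN, hHp, hL1, hKodd⟩ := hFH W hw p hp 0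
  have hsplit : ((Ideal.span {(p : ℤ)}).primesOver (NumberField.RingOfIntegers K)).ncard = 2 :=
    hHp p hp dvd_rfl
  have hcop : IsCoprime (NumberField.discr K) (W.conductorNorm ℤ : ℤ) := by
    rw [Int.isCoprime_iff_gcd_eq_one, Int.gcd_comm]
    exact Literature.SatisfiesHeegnerHypothesis.coprime_discr hK.1 hHN
  -- Step 3: a Heegner point, the newform of the twist, the canonical `p`-adic height over `K`
  obtain ⟨P, hP⟩ := hHeeg W K hK hHN
  have hdK : (NumberField.discr K : ℚ) ≠ 0 := by exact_mod_cast NumberField.discr_ne_zero K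
  haveI := W.isElliptic_quadraticTwist hdK
  haveI : NeZero ((W.quadraticTwist (NumberField.discr K : ℚ)).conductorNorm ℤ) :=
    ⟨((W.quadraticTwist (NumberField.discr K : ℚ)).conductorNorm_pos_holds).ne'⟩
  obtain ⟨g, hg⟩ := hmod (W.quadraticTwist (NumberField.discr K : ℚ))
  obtain ⟨DK, hDK⟩ := s1a_exists_isCanonicalK W K p h5 hord.1 hord.2
    (s1a_card_ringHom_padic hK.1 (by omega) hsplit)
  -- Step 4: Perrin-Riou's formula at the Heegner point, which is TORSION since `L'(E/K,1) = 0`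
  have hPR1 := (hPR W p K (W.conductorNorm ℤ) hf hg h5 hord.1 hord.2 hK hKodd hcop rfl hHN hsplit
    DK hDK P hP).2
  have htors : IsOfFinAddOrder P := by
    by_contra hnt
    exact (lDerivEK_ne_zero_iff_not_isOfFinAddOrder W (W.conductorNorm ℤ) K (hGZ _ W K) hK hHN
      hP).mpr hnt (s1a_lDerivEK_eq_zero W K hf hg (by omega))
  have hc1 : PowerSeries.coeff 1 (padicLFunctionEK W p K hf hg) = 0 :=
    hPR1.mpr (DK.map_torsion P P htors)
  -- Step 5: `L_p(E/K) = L_p(f,α) L_p(g,α)`, `L_p(f,α,0) = 0`, `L_p(g,α,0) ≠ 0`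
  rw [padicLFunctionEK_of_split W p K hf hg hsplit, PowerSeries.coeff_mul,
    Finset.Nat.sum_antidiagonal_eq_sum_range_succ_mk, Finset.sum_range_succ,
    Finset.sum_range_succ, Finset.sum_range_zero, zero_add, Nat.sub_zero, Nat.sub_self,
    PowerSeries.coeff_zero_eq_constantCoeff_apply,
    (stub_constantCoeff_eq_zero_iff W p hord f hf).mpr (by omega), zero_mul, zero_add,
    PowerSeries.coeff_zero_eq_constantCoeff_apply] at hc1
  have hg0 : PowerSeries.constantCoeff (padicLFunction g (unitRoot W p : ℚ_[p])) ≠ 0 := by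
    obtain ⟨hsq, hne⟩ := isSquare_discr_of_ncard_primesOver_eq_two hK.1 hp hsplit
    rw [constantCoeff_padicLFunction_twist (NumberField.discr_ne_zero K) (by omega)
      ((legendreSym.eq_one_iff p hne).mpr hsq) hord hg]
    refine mul_ne_zero (pow_ne_zero _ (sub_ne_zero.mpr fun h ↦ ?_)) fun h0 ↦ hL1 ?_
    · exact s1_unitRoot_coe_ne_one W p hord (inv_eq_one.mp h.symm)
    · have hEt : (W.quadraticTwist (NumberField.discr K : ℚ)).HasEntireLFunction :=
        WeierstrassCurve.hasEntireLFunction_of_cuspCoeff_eq (strictWidthInfty_Gamma0 _) _ g hg.2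
      refine (s1_ratPlusSymbol_zero_eq_zero_iff hg
        ((W.quadraticTwist _).differentiable_entireLFunction hEt) fun s hs ↦ ?_).mp
        (by exact_mod_cast h0)
      rw [(W.quadraticTwist _).entireLFunction_eq_LSeries hEt (by linarith),
        hg.cuspFormLSeries_eq]
  exact (mul_eq_zero.mp hc1).resolve_right hg0

end Summit.BirchSwinnertonDyer.BirchSwinnertonDyer.Theorems
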